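import Literature.Topology.FourManifolds.LefschetzBaseHomologyRank
import Literature.Topology.FourManifolds.LefschetzBaseShadowLoops
import Literature.Topology.FourManifolds.LefschetzModelFacts
import HarnessLib

/-!
# The standard Lefschetz base of genus `g`, X: Milnor's Theorem 9.1 — the homology shadow exists

Topic `Literature/Topology/FourManifolds`; namespace `Literature.Topology.FourManifolds.LefschetzBase`.
Discharge of the named fact `exists_isChainShadow` of `LefschetzModelFacts.lean` (Milnor 1968,
Thm. 9.1 with Lemma 9.4 for the `A_{2g}` fibre `y² = x^{2g+1} + 1`, thickened to the base `Base g`):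
**`exists_isChainShadow_holds : ∀ g, ∃ σ, IsChainShadow g σ`** — a `ℤ`-linear bijection
`H₁(Base g; ℤ) → ℤ^{Fin g ⊕ Fin g}` sending the Hurewicz class of the `i`-th chain loop to the `i`-th
chain vector, so that `shadowMap g` (a `Classical.epsilon`) is an honest homology shadow.
Assembly of `homologyOne_base`, `chainVec_basis`, `bijective_of_dual` (`LefschetzBaseHomologyRank.lean`)
with the dual functionals `exists_dualFunctionals` (`LefschetzBaseShadowLoops.lean`): `Ψ` is onto and
a surjection from the free rank-`2g` module `H₁` onto `ℤ^{2g}` is injective; `σ := L ∘ Ψ` with `L`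
the basis change `e_i ↦ chainVec g i`.  Everything is proved.

## References
* J. Milnor, *Singular points of complex hypersurfaces*, Ann. of Math. Studies 61 (1968), §9,
  Thm. 9.1, Lemma 9.4. [Milnor1968]
-/

noncomputable section

open Set Function
open Literature.AlgebraicTopology.SingularHomology

namespace Literature.Topology.FourManifolds

namespace LefschetzBase

/-- **Milnor's Theorem 9.1 for the standard Lefschetz base**: a `ℤ`-linear bijection
`H₁(Base g; ℤ) → ℤ^{2g}` sending the class of the `i`-th chain loop to the `i`-th chain vector exists.
[cite: Milnor1968, Thm. 9.1] -/
theorem exists_isChainShadow_of (g : ℕ) :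
    ∃ σ : singularHomology ℤ ℤ (Base g) 1 →ₗ[ℤ] (Fin g ⊕ Fin g → ℤ), IsChainShadow g σ := by
  obtain ⟨hfin, hfree, hrk⟩ := homologyOne_base g
  obtain ⟨Ψ, hΨ⟩ := exists_dualFunctionals g
  obtain ⟨bV, hbV⟩ := chainVec_basis g
  haveI := hfin
  haveI := hfree
  have hbij := bijective_of_dual hrk (fun i : Fin (2 * g) => loopClass ℤ ℤ (1 : ℤ) (chainLoop g i)) Ψ hΨ
  let L : (Fin (2 * g) → ℤ) ≃ₗ[ℤ] (Fin g ⊕ Fin g → ℤ) := (Pi.basisFun ℤ (Fin (2 * g))).equiv bV (Equiv.refl _)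
  refine ⟨L.toLinearMap ∘ₗ Ψ, L.bijective.comp hbij, fun i hi => ?_⟩
  have h1 := hΨ ⟨i, hi⟩
  show L (Ψ (loopClass ℤ ℤ 1 (chainLoop g ((⟨i, hi⟩ : Fin (2 * g)) : ℕ)))) = chainVec g i
  rw [h1, ← Pi.basisFun_apply, Module.Basis.equiv_apply, Equiv.refl_apply, hbV]

/-- **Discharge of the named fact `exists_isChainShadow` (Milnor 1968, Thm. 9.1 / Lemma 9.4 for
`Base g`): the homology shadow exists for every genus.** [cite: Milnor1968, Thm. 9.1] -/
theorem exists_isChainShadow_holds : exists_isChainShadow := exists_isChainShadow_of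

end LefschetzBase

end Literature.Topology.FourManifolds
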